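import Mathlib
import Summits.NavierStokesRegularity.NavierStokesRegularity.Theorems.EulerZoomLiouvillePowerGaugeEulerLiouvilleLagrangianTraceTools
import Summits.NavierStokesRegularity.NavierStokesRegularity.Theorems.EulerZoomLiouvillePowerGaugeEulerLiouvilleMeanStrain
import Summits.NavierStokesRegularity.NavierStokesRegularity.Theorems.EulerZoomLiouvillePowerGaugeEulerLiouvilleForwardEscape
import HarnessLib

/-!
# Crux `EulerZoomLiouville.PowerGaugeEulerLiouville` (stmt-NavierStokesRegularity-19832): THE LAGRANGIAN TRACE LAW, staying labels (plate t59-LT of nsreg-p2 ROUND-54, part 1/2)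

Width/portrait piece for THE ONE STATEMENT `stub_selfSimilarC2Needle` (LEAD skeleton `Cruxes/PowerGaugeEulerLiouville/Lines/birth.lean` v111,
ns-typeII-p2 g16), `--supports stmt-NavierStokesRegularity-19832 --as helper`.  Text = nsreg-p2 g44's `NsregP2.R54.Trace.LagrangianTraceLaw ρ V`
(`r54/Sketch54.lean` sha16 f78682d2f4ee3f27) VERBATIM, for `−½ < ρ ≤ 1` (keys 09:01:11Z / 09:04:21Z: «ESC + MS + monotone convergence in the horizon +
cut-off independence on tube trajectories»).

For a self-similar Euler profile `(V, P)` (`γ = 1/(2+ρ)`) with finite weighted strain budget `∫‖DV‖²‖y‖^{ρ−1} < ∞` and the A-gauge, along ANY global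
forward similarity flow `Φ` (interface `IsForwardSimilarityFlow`: `Φ_0 = id`, `∂_sΦ_s y = γΦ_s y + V(Φ_s y)` for `s ≥ 0`), almost every label has
INTEGRABLE STRAIN `∫_0^∞ ‖DV(Φ_s y)‖ ds < ∞` (`lagrangianTraceLaw`).  Proof: fix `C ≥ 2`, `L ≥ 1` and cut-offs `V′_S` for every horizon `S ∈ ℕ`
(`Trace.exists_C2_cutoff`).  By cut-off independence (`Trace.traj_eq_flow_of_flow_stay`, `…_of_mem_ball`) the labels whose cut-off orbit stays in
the `CL`-tube up to `S` form a DECREASING family `Stay S` on which `Φ = Ψ^{(S)}`; its complement in `B_L` lies in the escape set, of volume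
`≤ 8A(CL)^{−(1+2ρ)}` for every `S` (ns-ezl-w3's ★ `Trace.forwardEscapeLaw`), hence so does `B_L ∖ ⋂_S Stay S` (monotone union); on `⋂_S Stay S`
THE MEAN STRAIN LAW (`Trace.meanStrainLaw`, bound `M` UNIFORM in `S`) and monotone convergence give `∫_{⋂ Stay} ∫_0^∞‖DV(Φ_s y)‖ ≤ M`, so the strain is
integrable a.e. there; thus `vol{y ∈ B_L : strain not integrable} ≤ 8A(CL)^{−(1+2ρ)}` for every `C`, i.e. `0` (`ρ > −½`), for every `L`.
With ★ `RayVorticity.rayVorticityLaw` (ns-ezl-w3, p707221) this makes R54's `ae_vorticityLimit_of_traceLaw` unconditional.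

HONEST FRAMING: a portrait instrument about HYPOTHETICAL profiles; nothing about the crux E (19832 OPEN) or NS regularity is proved.
[nsreg-p2 R54 §C t59-LT; cite: ConstantinIgnatovaVicol2026Putative, §3.4.1 eq. (3.21)–(3.22), §3.5]
-/

noncomputable section

set_option linter.dupNamespace false

open MeasureTheory Set Filter Topology Metric Function
open scoped RealInnerProductSpace NNReal ENNReal ContDiff

namespace Summit.NavierStokesRegularity.NavierStokesRegularity.Theorems.PowerGaugeEulerLiouville.Trace

open Literature.Analysis Literature.Analysis.FluidPDE
open Summit.NavierStokesRegularity.NavierStokesRegularity.Theorems.PowerGaugeEulerLiouville.BernoulliLandscape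
open Summit.NavierStokesRegularity.NavierStokesRegularity.Theorems.PowerGaugeEulerLiouville.NeedleFeeding

/-- `⋃_{n ∈ ℕ} [0, n] = [0, ∞)` in `ℝ`. [folklore] -/
theorem iUnion_Icc_nat_eq_Ici : (⋃ n : ℕ, Icc (0 : ℝ) n) = Ici 0 := by
  ext s
  simp only [mem_iUnion, mem_Icc, mem_Ici]
  constructor
  · rintro ⟨n, h0, -⟩; exact h0
  · intro h; obtain ⟨n, hn⟩ := exists_nat_ge s; exact ⟨n, h, hn⟩

/-- **Cut-off independence on a staying cut-off orbit (tube form).**  If the cut-off orbit of `y` stays in the `CL`-tube on `[0, S]` and the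
cut-off radius exceeds `CLe^{S/(2+ρ)}`, the true trajectory from `y` coincides with it on `[0, S]`. [cite: ConstantinIgnatovaVicol2026Putative, §3.4.1 eq. (3.21)] -/
theorem traj_eq_cutoffFlow_of_flow_stay {ρ : ℝ} (h2ρ : 0 < 2 + ρ)
    {V V' : EuclideanSpace ℝ (Fin 3) → EuclideanSpace ℝ (Fin 3)} {K C L S Rb : ℝ} (hCL : 0 ≤ C * L)
    (hV' : ContDiff ℝ 2 V') (hK : ∀ y, ‖fderiv ℝ V' y‖ ≤ K) (hVV' : ∀ w ∈ ball (0 : EuclideanSpace ℝ (Fin 3)) Rb, V' w = V w)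
    (hRb : C * L * Real.exp (S / (2 + ρ)) < Rb) (hS : 0 ≤ S)
    {X : ℝ → EuclideanSpace ℝ (Fin 3)} {y : EuclideanSpace ℝ (Fin 3)} (hX0 : X 0 = y)
    (hX : ∀ s : ℝ, 0 ≤ s → HasDerivAt X ((1 / (2 + ρ)) • X s + V (X s)) s)
    (hstay : ∀ σ ∈ Icc 0 S, ‖ODE.evolutionMap (fun _ : ℝ => selfSimilarTransport (1 / (2 + ρ)) (0 : EuclideanSpace ℝ (Fin 3)) V') 0 σ y‖ ≤
      C * L * Real.exp (σ / (2 + ρ))) :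
    ∀ σ ∈ Icc 0 S, X σ = ODE.evolutionMap (fun _ : ℝ => selfSimilarTransport (1 / (2 + ρ)) (0 : EuclideanSpace ℝ (Fin 3)) V') 0 σ y := by
  subst hX0
  refine traj_eq_flow_of_flow_stay (γ := 1 / (2 + ρ)) hV' hK hVV' hX hS hRb fun s hs => (hstay s hs).trans ?_
  exact mul_le_mul_of_nonneg_left (Real.exp_le_exp.2 (div_le_div_of_nonneg_right hs.2 h2ρ.le)) hCL

/-- **Cut-off independence on a staying true trajectory (tube form).**  If the TRUE trajectory from `y` stays in the `CL`-tube on `[0, S]` and the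
cut-off radius exceeds `CLe^{S/(2+ρ)}`, it coincides with the cut-off orbit on `[0, S]`. [cite: ConstantinIgnatovaVicol2026Putative, §3.4.1 eq. (3.21)] -/
theorem traj_eq_cutoffFlow_of_traj_stay {ρ : ℝ} (h2ρ : 0 < 2 + ρ)
    {V V' : EuclideanSpace ℝ (Fin 3) → EuclideanSpace ℝ (Fin 3)} {K C L S Rb : ℝ} (hCL : 0 ≤ C * L)
    (hV' : ContDiff ℝ 2 V') (hK : ∀ y, ‖fderiv ℝ V' y‖ ≤ K) (hVV' : ∀ w ∈ ball (0 : EuclideanSpace ℝ (Fin 3)) Rb, V' w = V w)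
    (hRb : C * L * Real.exp (S / (2 + ρ)) < Rb)
    {X : ℝ → EuclideanSpace ℝ (Fin 3)} {y : EuclideanSpace ℝ (Fin 3)} (hX0 : X 0 = y)
    (hX : ∀ s : ℝ, 0 ≤ s → HasDerivAt X ((1 / (2 + ρ)) • X s + V (X s)) s)
    (htube : ∀ σ ∈ Icc 0 S, ‖X σ‖ ≤ C * L * Real.exp (σ / (2 + ρ))) :
    ∀ σ ∈ Icc 0 S, X σ = ODE.evolutionMap (fun _ : ℝ => selfSimilarTransport (1 / (2 + ρ)) (0 : EuclideanSpace ℝ (Fin 3)) V') 0 σ y := by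
  subst hX0
  refine traj_eq_flow_of_mem_ball (γ := 1 / (2 + ρ)) hV' hK hVV' hX fun s hs => ?_
  rw [mem_ball_zero_iff]
  refine lt_of_le_of_lt ((htube s hs).trans ?_) hRb
  exact mul_le_mul_of_nonneg_left (Real.exp_le_exp.2 (div_le_div_of_nonneg_right hs.2 h2ρ.le)) hCL

/-- **The horizon-`S` strain functional is measurable in the label** (Tonelli measurability of the `labels × time` integrand of THE MEAN STRAIN LAW).
[folklore] -/
theorem measurable_strainFunctional {γ : ℝ} {V' : EuclideanSpace ℝ (Fin 3) → EuclideanSpace ℝ (Fin 3)} {K : ℝ}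
    (hV' : ContDiff ℝ 2 V') (hK : ∀ y, ‖fderiv ℝ V' y‖ ≤ K) {f : ℝ → ℝ} (hf : Continuous f) (S : ℝ) :
    Measurable fun y : EuclideanSpace ℝ (Fin 3) => ∫⁻ σ in Icc 0 S,
      indicator {σ' : ℝ | ∀ σ'' ∈ Icc 0 σ', ‖ODE.evolutionMap (fun _ : ℝ => selfSimilarTransport γ 0 V') 0 σ'' y‖ ≤ f σ''}
        (fun σ' : ℝ => ‖fderiv ℝ V' (ODE.evolutionMap (fun _ : ℝ => selfSimilarTransport γ 0 V') 0 σ' y)‖ₑ) σ := by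
  obtain ⟨Ψ, hΨ⟩ : ∃ Ψ : ℝ → EuclideanSpace ℝ (Fin 3) → EuclideanSpace ℝ (Fin 3),
      Ψ = ODE.evolutionMap (fun _ : ℝ => selfSimilarTransport γ (0 : EuclideanSpace ℝ (Fin 3)) V') 0 := ⟨_, rfl⟩
  rw [← hΨ]
  obtain ⟨T, hT⟩ : ∃ T : Set (EuclideanSpace ℝ (Fin 3) × ℝ), T = {p | ∀ σ'' ∈ Icc 0 p.2, ‖Ψ σ'' p.1‖ ≤ f σ''} := ⟨_, rfl⟩
  have hTm : MeasurableSet T := by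
    rw [hT, hΨ]; exact measurableSet_forwardStayProd (γ := γ) hV' hK hf
  have hHm : Measurable fun p : EuclideanSpace ℝ (Fin 3) × ℝ => ‖fderiv ℝ V' (Ψ p.2 p.1)‖ₑ := by
    rw [hΨ]
    exact ((hV'.continuous_fderiv (by norm_num)).comp
      ((continuous_flow_uncurry (γ := γ) hV' hK).comp (continuous_snd.prodMk continuous_fst))).measurable.enorm
  have hunc : (Function.uncurry fun (y : EuclideanSpace ℝ (Fin 3)) (σ : ℝ) =>
      indicator {σ' : ℝ | ∀ σ'' ∈ Icc 0 σ', ‖Ψ σ'' y‖ ≤ f σ''} (fun σ' : ℝ => ‖fderiv ℝ V' (Ψ σ' y)‖ₑ) σ) =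
      T.indicator fun p => ‖fderiv ℝ V' (Ψ p.2 p.1)‖ₑ := by
    funext p
    obtain ⟨y, σ⟩ := p
    rw [hT, Function.uncurry_apply_pair]
    by_cases h : ∀ σ'' ∈ Icc 0 σ, ‖Ψ σ'' y‖ ≤ f σ''
    · rw [indicator_of_mem (show σ ∈ {σ' : ℝ | ∀ σ'' ∈ Icc 0 σ', ‖Ψ σ'' y‖ ≤ f σ''} from h),
        indicator_of_mem (show (y, σ) ∈ {p : EuclideanSpace ℝ (Fin 3) × ℝ | ∀ σ'' ∈ Icc 0 p.2, ‖Ψ σ'' p.1‖ ≤ f σ''} from h)]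
    · rw [indicator_of_notMem (show σ ∉ {σ' : ℝ | ∀ σ'' ∈ Icc 0 σ', ‖Ψ σ'' y‖ ≤ f σ''} from h),
        indicator_of_notMem (show (y, σ) ∉ {p : EuclideanSpace ℝ (Fin 3) × ℝ | ∀ σ'' ∈ Icc 0 p.2, ‖Ψ σ'' p.1‖ ≤ f σ''} from h)]
  have hF : Measurable (Function.uncurry fun (y : EuclideanSpace ℝ (Fin 3)) (σ : ℝ) =>
      indicator {σ' : ℝ | ∀ σ'' ∈ Icc 0 σ', ‖Ψ σ'' y‖ ≤ f σ''} (fun σ' : ℝ => ‖fderiv ℝ V' (Ψ σ' y)‖ₑ) σ) := by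
    rw [hunc]; exact hHm.indicator hTm
  exact hF.lintegral_prod_right'

/-- **Cut-off independence on the staying labels**: on `Stay S` the true trajectory is the cut-off orbit of horizon `S` on `[0, S]`.
[nsreg-p2 R54 §C t59-LT; cite: ConstantinIgnatovaVicol2026Putative, §3.4.1 eq. (3.21)] -/
theorem traj_eq_cutoffFlow_on_stay {ρ : ℝ} (hρ : -2 < ρ)
    {V : EuclideanSpace ℝ (Fin 3) → EuclideanSpace ℝ (Fin 3)} {Φ : ℝ → EuclideanSpace ℝ (Fin 3) → EuclideanSpace ℝ (Fin 3)} (hΦ0 : ∀ y, Φ 0 y = y)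
    (hΦ : ∀ y (s : ℝ), 0 ≤ s → HasDerivAt (fun σ => Φ σ y) ((1 / (2 + ρ)) • Φ s y + V (Φ s y)) s)
    {C L : ℝ} (hC : 2 ≤ C) (hL : 1 ≤ L)
    {Vc : ℕ → EuclideanSpace ℝ (Fin 3) → EuclideanSpace ℝ (Fin 3)} {Kc : ℕ → ℝ} (hVc : ∀ S, ContDiff ℝ 2 (Vc S)) (hKc : ∀ S y, ‖fderiv ℝ (Vc S) y‖ ≤ Kc S)
    (hVcV : ∀ S : ℕ, ∀ w ∈ ball (0 : EuclideanSpace ℝ (Fin 3)) (2 * C * L * Real.exp ((S : ℝ) / (2 + ρ)) + 1), Vc S w = V w)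
    {Ψ : ℕ → ℝ → EuclideanSpace ℝ (Fin 3) → EuclideanSpace ℝ (Fin 3)}
    (hΨ : Ψ = fun (S : ℕ) (σ : ℝ) (y : EuclideanSpace ℝ (Fin 3)) =>
      ODE.evolutionMap (fun _ : ℝ => selfSimilarTransport (1 / (2 + ρ)) (0 : EuclideanSpace ℝ (Fin 3)) (Vc S)) 0 σ y)
    {Stay : ℕ → Set (EuclideanSpace ℝ (Fin 3))}
    (hStay : Stay = fun S : ℕ => {y ∈ ball (0 : EuclideanSpace ℝ (Fin 3)) L | ∀ σ ∈ Icc 0 (S : ℝ), ‖Ψ S σ y‖ ≤ C * L * Real.exp (σ / (2 + ρ))})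
    {S : ℕ} {y : EuclideanSpace ℝ (Fin 3)} (hy : y ∈ Stay S) : ∀ σ ∈ Icc 0 (S : ℝ), Φ σ y = Ψ S σ y := by
  have h2ρ : 0 < 2 + ρ := by linarith
  have hCL0 : 0 < C * L := by nlinarith
  have hRbig' : C * L * Real.exp ((S : ℝ) / (2 + ρ)) < 2 * C * L * Real.exp ((S : ℝ) / (2 + ρ)) + 1 := by
    have := Real.exp_pos ((S : ℝ) / (2 + ρ)); nlinarith
  intro σ hσ
  rw [hStay] at hy
  have hst : ∀ s ∈ Icc 0 (S : ℝ),
      ‖ODE.evolutionMap (fun _ : ℝ => selfSimilarTransport (1 / (2 + ρ)) (0 : EuclideanSpace ℝ (Fin 3)) (Vc S)) 0 s y‖ ≤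
        C * L * Real.exp (s / (2 + ρ)) := fun s hs => by have h := hy.2 s hs; rw [hΨ] at h; exact h
  have h := traj_eq_cutoffFlow_of_flow_stay h2ρ hCL0.le (hVc S) (hKc S) (hVcV S) hRbig' (Nat.cast_nonneg S)
    (X := fun σ => Φ σ y) (hΦ0 y) (hΦ y) hst σ hσ
  rw [hΨ]; exact h

/-- **The staying families decrease with the horizon** (cut-off independence both ways). [nsreg-p2 R54 §C t59-LT; cite: ConstantinIgnatovaVicol2026Putative, §3.4.1 eq. (3.21)] -/
theorem stay_antitone {ρ : ℝ} (hρ : -2 < ρ)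
    {V : EuclideanSpace ℝ (Fin 3) → EuclideanSpace ℝ (Fin 3)} {Φ : ℝ → EuclideanSpace ℝ (Fin 3) → EuclideanSpace ℝ (Fin 3)} (hΦ0 : ∀ y, Φ 0 y = y)
    (hΦ : ∀ y (s : ℝ), 0 ≤ s → HasDerivAt (fun σ => Φ σ y) ((1 / (2 + ρ)) • Φ s y + V (Φ s y)) s)
    {C L : ℝ} (hC : 2 ≤ C) (hL : 1 ≤ L)
    {Vc : ℕ → EuclideanSpace ℝ (Fin 3) → EuclideanSpace ℝ (Fin 3)} {Kc : ℕ → ℝ} (hVc : ∀ S, ContDiff ℝ 2 (Vc S)) (hKc : ∀ S y, ‖fderiv ℝ (Vc S) y‖ ≤ Kc S)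
    (hVcV : ∀ S : ℕ, ∀ w ∈ ball (0 : EuclideanSpace ℝ (Fin 3)) (2 * C * L * Real.exp ((S : ℝ) / (2 + ρ)) + 1), Vc S w = V w)
    {Ψ : ℕ → ℝ → EuclideanSpace ℝ (Fin 3) → EuclideanSpace ℝ (Fin 3)}
    (hΨ : Ψ = fun (S : ℕ) (σ : ℝ) (y : EuclideanSpace ℝ (Fin 3)) =>
      ODE.evolutionMap (fun _ : ℝ => selfSimilarTransport (1 / (2 + ρ)) (0 : EuclideanSpace ℝ (Fin 3)) (Vc S)) 0 σ y)
    {Stay : ℕ → Set (EuclideanSpace ℝ (Fin 3))}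
    (hStay : Stay = fun S : ℕ => {y ∈ ball (0 : EuclideanSpace ℝ (Fin 3)) L | ∀ σ ∈ Icc 0 (S : ℝ), ‖Ψ S σ y‖ ≤ C * L * Real.exp (σ / (2 + ρ))}) :
    ∀ S S' : ℕ, S ≤ S' → Stay S' ⊆ Stay S := by
  have h2ρ : 0 < 2 + ρ := by linarith
  have hCL0 : 0 < C * L := by nlinarith
  have hRbig' : ∀ S : ℕ, C * L * Real.exp ((S : ℝ) / (2 + ρ)) < 2 * C * L * Real.exp ((S : ℝ) / (2 + ρ)) + 1 := fun S => by
    have := Real.exp_pos ((S : ℝ) / (2 + ρ)); nlinarith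
  intro S S' hSS' y hy
  have hid := traj_eq_cutoffFlow_on_stay hρ hΦ0 hΦ hC hL hVc hKc hVcV hΨ hStay hy
  rw [hStay] at hy ⊢
  have hyL : y ∈ ball (0 : EuclideanSpace ℝ (Fin 3)) L := hy.1
  have htube : ∀ s ∈ Icc 0 (S : ℝ), ‖(fun σ => Φ σ y) s‖ ≤ C * L * Real.exp (s / (2 + ρ)) := by
    intro s hs
    have hs' : s ∈ Icc 0 (S' : ℝ) := ⟨hs.1, hs.2.trans (by exact_mod_cast hSS')⟩
    show ‖Φ s y‖ ≤ _
    rw [hid s hs']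
    exact hy.2 s hs'
  refine ⟨hyL, fun σ hσ => ?_⟩
  have h := traj_eq_cutoffFlow_of_traj_stay h2ρ hCL0.le (hVc S) (hKc S) (hVcV S) (hRbig' S)
    (X := fun σ => Φ σ y) (hΦ0 y) (hΦ y) htube σ hσ
  rw [hΨ]
  show ‖ODE.evolutionMap (fun _ : ℝ => selfSimilarTransport (1 / (2 + ρ)) (0 : EuclideanSpace ℝ (Fin 3)) (Vc S)) 0 σ y‖ ≤ _
  rw [← h]
  exact htube σ hσ

/-- **The non-staying labels are few**: `vol(B_L ∖ ⋂_S Stay S) ≤ 8A(CL)^{−(1+2ρ)}` (monotone union of the complements, each inside the horizon-`S`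
escape set of ★ `Trace.forwardEscapeLaw`). [nsreg-p2 R54 §C t59-LT; cite: ConstantinIgnatovaVicol2026Putative, §3.5] -/
theorem volume_ball_diff_iInter_stay_le {ρ : ℝ} (hρ : -2 < ρ)
    {V : EuclideanSpace ℝ (Fin 3) → EuclideanSpace ℝ (Fin 3)} {P : EuclideanSpace ℝ (Fin 3) → ℝ} (hprof : IsSelfSimilarEulerProfile (1 / (2 + ρ)) 0 V P) {A : ℝ}
    (hA : ∀ R : ℝ, 1 ≤ R → ∫ y in ball (0 : EuclideanSpace ℝ (Fin 3)) R, ‖V y‖ ^ 2 ≤ A * R ^ (1 - 2 * ρ))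
    {Φ : ℝ → EuclideanSpace ℝ (Fin 3) → EuclideanSpace ℝ (Fin 3)} (hΦ0 : ∀ y, Φ 0 y = y)
    (hΦ : ∀ y (s : ℝ), 0 ≤ s → HasDerivAt (fun σ => Φ σ y) ((1 / (2 + ρ)) • Φ s y + V (Φ s y)) s)
    {C L : ℝ} (hC : 2 ≤ C) (hL : 1 ≤ L)
    {Vc : ℕ → EuclideanSpace ℝ (Fin 3) → EuclideanSpace ℝ (Fin 3)} {Kc : ℕ → ℝ} (hVc : ∀ S, ContDiff ℝ 2 (Vc S)) (hKc : ∀ S y, ‖fderiv ℝ (Vc S) y‖ ≤ Kc S)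
    (hVcV : ∀ S : ℕ, ∀ w ∈ ball (0 : EuclideanSpace ℝ (Fin 3)) (2 * C * L * Real.exp ((S : ℝ) / (2 + ρ)) + 1), Vc S w = V w)
    {Ψ : ℕ → ℝ → EuclideanSpace ℝ (Fin 3) → EuclideanSpace ℝ (Fin 3)}
    (hΨ : Ψ = fun (S : ℕ) (σ : ℝ) (y : EuclideanSpace ℝ (Fin 3)) =>
      ODE.evolutionMap (fun _ : ℝ => selfSimilarTransport (1 / (2 + ρ)) (0 : EuclideanSpace ℝ (Fin 3)) (Vc S)) 0 σ y)
    {Stay : ℕ → Set (EuclideanSpace ℝ (Fin 3))}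
    (hStay : Stay = fun S : ℕ => {y ∈ ball (0 : EuclideanSpace ℝ (Fin 3)) L | ∀ σ ∈ Icc 0 (S : ℝ), ‖Ψ S σ y‖ ≤ C * L * Real.exp (σ / (2 + ρ))}) :
    volume (ball (0 : EuclideanSpace ℝ (Fin 3)) L \ ⋂ S, Stay S) ≤ ENNReal.ofReal (8 * A * (C * L) ^ (-(1 + 2 * ρ))) := by
  have hRbig : ∀ S : ℕ, 2 * C * L * Real.exp ((S : ℝ) / (2 + ρ)) < 2 * C * L * Real.exp ((S : ℝ) / (2 + ρ)) + 1 := fun S => by linarith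
  have hanti := stay_antitone hρ hΦ0 hΦ hC hL hVc hKc hVcV hΨ hStay
  have hesc : ∀ S : ℕ, volume (ball (0 : EuclideanSpace ℝ (Fin 3)) L \ Stay S) ≤ ENNReal.ofReal (8 * A * (C * L) ^ (-(1 + 2 * ρ))) := by
    intro S
    have hsub : ball (0 : EuclideanSpace ℝ (Fin 3)) L \ Stay S ⊆ {y ∈ ball (0 : EuclideanSpace ℝ (Fin 3)) L |
        ∃ s ∈ Icc 0 (S : ℝ), C * L * Real.exp (s / (2 + ρ)) ≤
          ‖ODE.evolutionMap (fun _ : ℝ => selfSimilarTransport (1 / (2 + ρ)) (0 : EuclideanSpace ℝ (Fin 3)) (Vc S)) 0 s y‖} := by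
      rintro y ⟨hyL, hyS⟩
      rw [hStay] at hyS
      simp only [mem_setOf_eq, not_and, not_forall, not_le] at hyS
      obtain ⟨s, hs, hlt⟩ := hyS hyL
      refine ⟨hyL, s, hs, ?_⟩
      rw [hΨ] at hlt
      exact hlt.le
    have hfin : volume {y ∈ ball (0 : EuclideanSpace ℝ (Fin 3)) L |
        ∃ s ∈ Icc 0 (S : ℝ), C * L * Real.exp (s / (2 + ρ)) ≤
          ‖ODE.evolutionMap (fun _ : ℝ => selfSimilarTransport (1 / (2 + ρ)) (0 : EuclideanSpace ℝ (Fin 3)) (Vc S)) 0 s y‖} ≠ ⊤ :=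
      (lt_of_le_of_lt (measure_mono (fun y hy => hy.1)) measure_ball_lt_top).ne
    have hlaw := forwardEscapeLaw hρ V P hprof A hA C L S (Vc S) (Kc S) (2 * C * L * Real.exp ((S : ℝ) / (2 + ρ)) + 1) hC hL
      (Nat.cast_nonneg S) (hVc S) (hKc S) (hRbig S) (hVcV S)
    refine (measure_mono hsub).trans ?_
    rw [← ENNReal.ofReal_toReal hfin]
    exact ENNReal.ofReal_le_ofReal hlaw
  have e : ball (0 : EuclideanSpace ℝ (Fin 3)) L \ (⋂ S, Stay S) = ⋃ S, (ball (0 : EuclideanSpace ℝ (Fin 3)) L \ Stay S) := by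
    ext y
    simp only [mem_iInter, mem_iUnion, not_forall, Set.mem_sdiff]
    constructor
    · rintro ⟨hyL, S, hS⟩; exact ⟨S, hyL, hS⟩
    · rintro ⟨S, hyL, hS⟩; exact ⟨hyL, S, hS⟩
  rw [e]
  have hmono : Monotone fun S : ℕ => ball (0 : EuclideanSpace ℝ (Fin 3)) L \ Stay S :=
    fun S S' hSS' y hy => ⟨hy.1, fun h => hy.2 (hanti S S' hSS' h)⟩
  rw [hmono.measure_iUnion]
  exact iSup_le hesc

/-- **On the staying labels the strain is a.e. integrable**: THE MEAN STRAIN LAW with its horizon-uniform bound, cut-off independence, and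
monotone convergence. [nsreg-p2 R54 §C t59-LT; cite: ConstantinIgnatovaVicol2026Putative, §3.4.1 eq. (3.22)] -/
theorem ae_integrableOn_strain_of_iInter_stay {ρ : ℝ} (hρ : -2 < ρ) (hρ1 : ρ ≤ 1)
    {V : EuclideanSpace ℝ (Fin 3) → EuclideanSpace ℝ (Fin 3)} {P : EuclideanSpace ℝ (Fin 3) → ℝ} (hprof : IsSelfSimilarEulerProfile (1 / (2 + ρ)) 0 V P)
    (hE : (∫⁻ y, ‖fderiv ℝ V y‖ₑ ^ 2 * ENNReal.ofReal (‖y‖ ^ (ρ - 1))) ≠ ⊤)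
    {Φ : ℝ → EuclideanSpace ℝ (Fin 3) → EuclideanSpace ℝ (Fin 3)} (hΦ0 : ∀ y, Φ 0 y = y)
    (hΦ : ∀ y (s : ℝ), 0 ≤ s → HasDerivAt (fun σ => Φ σ y) ((1 / (2 + ρ)) • Φ s y + V (Φ s y)) s)
    {C L : ℝ} (hC : 2 ≤ C) (hL : 1 ≤ L)
    {Vc : ℕ → EuclideanSpace ℝ (Fin 3) → EuclideanSpace ℝ (Fin 3)} {Kc : ℕ → ℝ} (hVc : ∀ S, ContDiff ℝ 2 (Vc S)) (hKc : ∀ S y, ‖fderiv ℝ (Vc S) y‖ ≤ Kc S)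
    (hVcV : ∀ S : ℕ, ∀ w ∈ ball (0 : EuclideanSpace ℝ (Fin 3)) (2 * C * L * Real.exp ((S : ℝ) / (2 + ρ)) + 1), Vc S w = V w)
    {Ψ : ℕ → ℝ → EuclideanSpace ℝ (Fin 3) → EuclideanSpace ℝ (Fin 3)}
    (hΨ : Ψ = fun (S : ℕ) (σ : ℝ) (y : EuclideanSpace ℝ (Fin 3)) =>
      ODE.evolutionMap (fun _ : ℝ => selfSimilarTransport (1 / (2 + ρ)) (0 : EuclideanSpace ℝ (Fin 3)) (Vc S)) 0 σ y)
    {Stay : ℕ → Set (EuclideanSpace ℝ (Fin 3))}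
    (hStay : Stay = fun S : ℕ => {y ∈ ball (0 : EuclideanSpace ℝ (Fin 3)) L | ∀ σ ∈ Icc 0 (S : ℝ), ‖Ψ S σ y‖ ≤ C * L * Real.exp (σ / (2 + ρ))})
    (hStaym : ∀ S, MeasurableSet (Stay S)) :
    ∀ᵐ y : EuclideanSpace ℝ (Fin 3), y ∈ (⋂ S, Stay S) → IntegrableOn (fun s => ‖fderiv ℝ V (Φ s y)‖) (Ici 0) := by
  have h2ρ : 0 < 2 + ρ := by linarith
  set γ : ℝ := 1 / (2 + ρ) with hγ
  have hC1 : 1 ≤ C := by linarith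
  have hCL0 : 0 < C * L := by nlinarith
  have hDVc : Continuous (fderiv ℝ V) := hprof.contDiff_velocity.continuous_fderiv (by norm_num)
  have hRbig : ∀ S : ℕ, 2 * C * L * Real.exp ((S : ℝ) / (2 + ρ)) < 2 * C * L * Real.exp ((S : ℝ) / (2 + ρ)) + 1 := fun S => by linarith
  have hStayball : ∀ S, Stay S ⊆ ball (0 : EuclideanSpace ℝ (Fin 3)) L := fun S y hy => by rw [hStay] at hy; exact hy.1
  -- the mean strain law, uniform in the horizon
  obtain ⟨M, hM⟩ := meanStrainLaw hρ hρ1 V P hprof hE C L hC1 hL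
  -- the horizon-`S` strain functional (measurable in the label)
  obtain ⟨g, hg⟩ : ∃ g : ℕ → EuclideanSpace ℝ (Fin 3) → ℝ≥0∞, g = fun (S : ℕ) (y : EuclideanSpace ℝ (Fin 3)) => ∫⁻ σ in Icc 0 (S : ℝ),
      indicator {σ' : ℝ | ∀ σ'' ∈ Icc 0 σ', ‖Ψ S σ'' y‖ ≤ C * L * Real.exp (σ'' / (2 + ρ))}
        (fun σ' : ℝ => ‖fderiv ℝ (Vc S) (Ψ S σ' y)‖ₑ) σ := ⟨_, rfl⟩
  have hgm : ∀ S, Measurable (g S) := by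
    intro S
    rw [hg, hΨ]
    exact measurable_strainFunctional (γ := γ) (hVc S) (hKc S) (f := fun σ'' => C * L * Real.exp (σ'' / (2 + ρ))) (by fun_prop) S
  have hgM : ∀ S, ∫⁻ y in ball (0 : EuclideanSpace ℝ (Fin 3)) L, g S y ≤ ENNReal.ofReal M := by
    intro S
    have h := hM S (Vc S) (Kc S) (2 * C * L * Real.exp ((S : ℝ) / (2 + ρ)) + 1) (Nat.cast_nonneg S) (hVc S) (hKc S) (hRbig S) (hVcV S)
    rw [hg]
    rw [hΨ]
    exact h
  -- on the staying labels the functional is the strain of the TRUE trajectory up to the horizon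
  obtain ⟨f, hf⟩ : ∃ f : EuclideanSpace ℝ (Fin 3) → ℝ → ℝ≥0∞, f = fun y s => ‖fderiv ℝ V (Φ (max s 0) y)‖ₑ := ⟨_, rfl⟩
  have hgf : ∀ (S : ℕ) (y : EuclideanSpace ℝ (Fin 3)), y ∈ Stay S → g S y = ∫⁻ σ in Icc 0 (S : ℝ), f y σ := by
    intro S y hy
    have hid := traj_eq_cutoffFlow_on_stay hρ hΦ0 hΦ hC hL hVc hKc hVcV hΨ hStay hy
    have hy' := hy
    rw [hStay] at hy'
    rw [hg]
    refine setLIntegral_congr_fun measurableSet_Icc (fun σ hσ => ?_)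
    have hmem : σ ∈ {σ' : ℝ | ∀ σ'' ∈ Icc 0 σ', ‖Ψ S σ'' y‖ ≤ C * L * Real.exp (σ'' / (2 + ρ))} :=
      fun σ'' hσ'' => hy'.2 σ'' ⟨hσ''.1, hσ''.2.trans hσ.2⟩
    rw [indicator_of_mem hmem, hf]
    simp only [max_eq_left hσ.1]
    rw [hid σ hσ]
    -- `DV′_S = DV` at the tube point `Ψ^S_σ y`
    have hin : Ψ S σ y ∈ ball (0 : EuclideanSpace ℝ (Fin 3)) (2 * C * L * Real.exp ((S : ℝ) / (2 + ρ)) + 1) := by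
      rw [mem_ball_zero_iff]
      refine lt_of_le_of_lt (hy'.2 σ hσ) ?_
      have : Real.exp (σ / (2 + ρ)) ≤ Real.exp ((S : ℝ) / (2 + ρ)) := Real.exp_le_exp.2 (div_le_div_of_nonneg_right hσ.2 h2ρ.le)
      nlinarith [Real.exp_pos ((S : ℝ) / (2 + ρ))]
    have hEq : Vc S =ᶠ[𝓝 (Ψ S σ y)] V := Filter.eventually_of_mem (isOpen_ball.mem_nhds hin) fun w hw => hVcV S w hw
    rw [hEq.fderiv_eq]
  -- monotone convergence on `⋂_S Stay S`
  obtain ⟨G, hG⟩ : ∃ G : EuclideanSpace ℝ (Fin 3) → ℝ≥0∞, G = fun y => ⨆ S : ℕ, (⋂ S', Stay S').indicator (g S) y := ⟨_, rfl⟩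
  have hIm : MeasurableSet (⋂ S, Stay S) := MeasurableSet.iInter hStaym
  have hGm : Measurable G := by
    rw [hG]
    exact Measurable.iSup fun S => (hgm S).indicator hIm
  have hmonog : Monotone fun S : ℕ => (⋂ S', Stay S').indicator (g S) := by
    refine monotone_nat_of_le_succ fun S y => ?_
    by_cases hy : y ∈ ⋂ S', Stay S'
    · rw [indicator_of_mem hy, indicator_of_mem hy, hgf S y (mem_iInter.1 hy S), hgf (S + 1) y (mem_iInter.1 hy (S + 1))]
      exact lintegral_mono_set (Icc_subset_Icc le_rfl (by push_cast; linarith))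
    · rw [indicator_of_notMem hy, indicator_of_notMem hy]
  have hGint : ∫⁻ y, G y ≤ ENNReal.ofReal M := by
    rw [hG, lintegral_iSup (fun S => (hgm S).indicator hIm) hmonog]
    refine iSup_le fun S => ?_
    rw [lintegral_indicator hIm]
    exact (lintegral_mono_set ((iInter_subset _ S).trans (hStayball S))).trans (hgM S)
  have hae : ∀ᵐ y, G y < ⊤ := ae_lt_top hGm (ne_top_of_le_ne_top ENNReal.ofReal_ne_top hGint)
  -- on `⋂_S Stay S`, a finite `G` means integrable strain along the TRUE trajectory
  have hgood : ∀ y, y ∈ (⋂ S, Stay S) → G y < ⊤ → IntegrableOn (fun s => ‖fderiv ℝ V (Φ s y)‖) (Ici 0) := by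
    intro y hy hGy
    have hXc : ContinuousOn (fun s => Φ s y) (Ici 0) := continuousOn_traj_Ici (γ := γ) (V := V) (hΦ y)
    have hcont : ContinuousOn (fun s => ‖fderiv ℝ V (Φ s y)‖) (Ici 0) := (hDVc.comp_continuousOn hXc).norm
    refine ⟨hcont.aestronglyMeasurable measurableSet_Ici, ?_⟩
    rw [hasFiniteIntegral_iff_enorm]
    have hle : ∫⁻ s in Ici (0 : ℝ), ‖(‖fderiv ℝ V (Φ s y)‖)‖ₑ ≤ G y := by
      have e1 : ∫⁻ s in Ici (0 : ℝ), ‖(‖fderiv ℝ V (Φ s y)‖)‖ₑ = ∫⁻ s in Ici (0 : ℝ), f y s := by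
        refine setLIntegral_congr_fun measurableSet_Ici (fun s hs => ?_)
        rw [hf]
        simp only [enorm_norm, max_eq_left (mem_Ici.1 hs)]
      rw [e1, ← iUnion_Icc_nat_eq_Ici, setLIntegral_iUnion_of_directed _
        (Monotone.directed_le fun S S' h => Icc_subset_Icc le_rfl (by exact_mod_cast h))]
      refine iSup_le fun S => ?_
      rw [← hgf S y (mem_iInter.1 hy S), hG]
      calc g S y = (⋂ S', Stay S').indicator (g S) y := by rw [indicator_of_mem hy]
        _ ≤ ⨆ S, (⋂ S', Stay S').indicator (g S) y := le_iSup (fun S => (⋂ S', Stay S').indicator (g S) y) S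
    exact lt_of_le_of_lt hle hGy
  -- conclude
  filter_upwards [hae] with y hGy hy
  exact hgood y hy hGy

end Summit.NavierStokesRegularity.NavierStokesRegularity.Theorems.PowerGaugeEulerLiouville.Trace
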